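import Summits.KontsevichZagierPeriods.Zeta5Search.Zudilin2002IntegralityFromKR
import HarnessLib

/-!
# Zudilin 2002's integrality: the contiguity transport is LOSSLESS, so the named fact follows from the first line of
his (14) alone (cell `pub-zeta5`, seat ct-1 g41)

HONEST FRAMING: systematic search; no irrationality claim unless certified.  `2`-adic bookkeeping of the coefficient
sequences `uₙ, wₙ, vₙ` of Zudilin's very-well-poised form `rₙ = uₙζ(5) + wₙζ(3) − vₙ` and `ũₙ, w̃ₙ, ṽₙ` of the partner
form `r̃ₙ` (Mat. Zametki **72** (2002) 796–800, §2 (7)–(9), (14)–(15)); nothing here concerns the arithmetic nature of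
`ζ(5)` or `ζ(3)`; records in print UNMOVED.  NOTHING IS DISCHARGED: the named Literature fact `Zudilin2002.integrality`
(`4D_n²qₙ, 4D_n⁷pₙ, 4D_n⁵p̃ₙ ∈ ℤ`) stays a named fact (net debt 0); what changes is the SIZE of its residual.

OUR work (Summit side), sequel of `Zudilin2002IntegralityFromKR` (seat ct-1 g40).  That file transports a `2`-adic bound on
an `r`-series `x ∈ {u, w, v}` to the partner series `x̃` along the cell's kernel-certified PARTNER CONTIGUITY
`b₀(n)x̃ₙ = −196n⁵xₙ₋₁ + c_B(n)xₙ − 87(n+1)⁵xₙ₊₁` (`Zudilin2002Minors.Contig`, `contig_uC/wC/vC`) with the LOSS OF ONE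
FACTOR `2`, because `ord₂ b₀(n) ≤ 1` was the only parity information used.  Reading the parities of ALL FOUR coefficients:

* `n` even: `b₀(n) = 41218n³ + 48459n² + 20010n + 2871` is ODD (`padicValuation_Q0_eq_one`) — nothing is lost;
* `n` odd: `b₀(n) ≡ 2 (mod 4)` (ct-1 g40), but then `−196n⁵ ≡ 0 (mod 4)`, `c_B(n) = 3(10130n⁵ + ⋯ + 261)` is EVEN
  (`two_dvd_cB`), and the third coefficient, after the `D`-bookkeeping `D_n^k(n+1)⁵xₙ₊₁ = (n+1)^{5−k}g^k·D_{n+1}^k xₙ₊₁`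
  with `g = gcd(D_n, n+1)` (`D_n(n+1) = g·D_{n+1}`), is `−87(n+1)^{5−k}g^k`, EVEN as soon as `k ≤ 4` or `n ≥ 3`
  (`g` is even for odd `n ≥ 3`) — so the factor `2` of `b₀(n)` is paid by the right-hand side;

hence **`transport_lossless`**: `Contig x x̃`, `k ≤ 5`, `ord₂(D_m^k x_m) ≥ −M` for all `m` ⇒ `ord₂(D_n^k x̃ₙ) ≥ −M` for every
`n ≥ 2`, and for every `n ≥ 1` when `k ≤ 4`.  The one exception (`n = 1`, `k = 5`) is real: `ord₂(D₁⁵ṽ₁) = −1 < 0 =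
ord₂(D_m⁵v_m)` (seat desk).  Consequences:

* `partner_of_rHalf` — the partner triple `(ũ, D²w̃, D⁵ṽ)` inherits the `2`-adic exponents of `(u, D²w, D⁵v)` verbatim for
  `n ≥ 2`;
* **`integrality_of_rHalf_printed`** — `Zudilin2002.integrality` follows from `ord₂(uₙ), ord₂(D_n²wₙ), ord₂(D_n⁵vₙ) ≥ −1`
  for all `n`, i.e. (`integrality_of_fourteen_rHalf`) from **the first line `2uₙ ∈ ℤ, 2D_n²wₙ ∈ ℤ, 2D_n⁵vₙ ∈ ℤ` of
  Zudilin's (14) ALONE** (the index `n = 1` by the cell's certificate `two_adic_upto_fifty`); ct-1 g40 needed the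
  Krattenthaler–Rivoal strength `ord₂ ≥ (0, 0, −1)`, one factor `2` sharper on `u` and `w`;
* `integrality_of_brick_two` / **`integrality_of_level_two`** — the same hypothesis in the vocabulary of the cell's brick
  kernel `(6,1,1)` (`uₙ = x_5(n)`, `wₙ = x_3(n)`, `vₙ = −x_0(n)`, `BrickLinearForms`): a `2`-adic analogue of zi-eng's
  constant-weight PROPOSITION H^∞ (`BrickDenominators.level_const`, proved at every ODD prime) that LOSES ONE FACTOR `2`,
  `v₂(2^{L(6−s)}x_s(n)) ≤ exp(1−L)` and `v₂(2^{6L}x_0(n)) ≤ exp(1−L)` for `n < 2^{L+1}`, closes the named fact.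

So the residual of `Zudilin2002.integrality` is now EXACTLY the prime-`2` content of the first line of (14) — in print a
consequence of Vasilyev's integrals and Zudilin's series = integral theorem (loc. cit., before (14)) —, no longer the
Krattenthaler–Rivoal saving in full; the partner line of (14) and ct-1 g40's `Zudilin2002IntegralityFromKR` README
caveat («a `p = 2` run that also loses a factor `2` on `x₅, x₃` makes the contiguity budget fail by one») are retired.
DATA (seat desk `alg/lossless_transport_check.py`, exact, `n ≤ 12`; not used by the kernel): `b₀(n) mod 4 = 3, 2, 3, 2, …`
(`n = 0, 1, …`), `c_B(n) mod 2 = 1, 0, 1, 0, …`, `g = gcd(D_n, n+1) = 1, 1, 2, 1, 6, 1, 4, 3, 10, 1, 12, 1, 14` (`n = 1..13`);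
slack of the lossless bound `ord₂(D_n^kx̃ₙ) − min_m ord₂(D_m^kx_m)` = `+1…+8` for `n = 2..12`, and `−1` at `(n, k) = (1, 5)` only.
-/

noncomputable section

open WithZero

namespace Summit.KontsevichZagierPeriods.Zeta5Search.Zudilin2002IntegralityLossless

open Literature.NumberTheory.Irrationality
open Literature.NumberTheory.Irrationality.Zudilin2002 (q p ptilde uC wC vC utC wtC vtC integrality)
open Summit.KontsevichZagierPeriods.Zeta5Search.Zudilin2002Minors (Contig Q0 QA QB QC b₀_eq contig_uC contig_wC
  contig_vC)
open Summit.KontsevichZagierPeriods.Zeta5Search.Zudilin2002IntegralityTwoAdic (integrality_iff_two_adic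
  padicValuation_intCast_le_one two_adic_of_coeffs two_adic_upto_fifty)
open Summit.KontsevichZagierPeriods.Zeta5Search.Zudilin2002IntegralityFromKR (exp_neg_one_le_padicValuation_Q0)
open Summit.KontsevichZagierPeriods.Zeta5Search.BrickDenominators (le_exp_of_pow_mul_le padicValuation_lcmUpto)
open Summit.KontsevichZagierPeriods.Zeta5Search.BrickLinearForms (uC_eq_xCoeff wC_eq_xCoeff vC_eq_neg_xZero)
open Summit.KontsevichZagierPeriods.Zeta5Search.BrickPartialFractions (xCoeff xZero)

/-! ### Bookkeeping: `D_n = lcm(1,…,n)` -/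

/-- `D_m ∣ D_{m+1}`. [folklore] -/
private theorem lcmUpto_dvd_succ (m : ℕ) : Nat.lcmUpto m ∣ Nat.lcmUpto (m + 1) := by
  unfold Nat.lcmUpto
  exact Finset.lcm_dvd fun i hi => Finset.dvd_lcm (by
    have := Finset.mem_Icc.1 hi; exact Finset.mem_Icc.2 ⟨this.1, this.2.trans (Nat.le_succ m)⟩)

/-- `D_{m+1} = lcm(D_m, m+1)`. [folklore] -/
private theorem lcmUpto_succ (m : ℕ) : Nat.lcmUpto (m + 1) = Nat.lcm (Nat.lcmUpto m) (m + 1) := by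
  unfold Nat.lcmUpto
  have h : Finset.Icc 1 (m + 1) = insert (m + 1) (Finset.Icc 1 m) := by
    ext i; simp only [Finset.mem_Icc, Finset.mem_insert]; omega
  rw [h, Finset.lcm_insert, lcm_comm]
  rfl

/-- `D_m·(m+1) = gcd(D_m, m+1)·D_{m+1}`. [folklore] -/
private theorem lcmUpto_mul_succ (m : ℕ) :
    Nat.lcmUpto m * (m + 1) = Nat.gcd (Nat.lcmUpto m) (m + 1) * Nat.lcmUpto (m + 1) := by
  rw [lcmUpto_succ, Nat.gcd_mul_lcm]

/-- `2 ∣ D_m` for `m ≥ 2`. [folklore] -/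
private theorem two_dvd_lcmUpto {m : ℕ} (hm : 2 ≤ m) : 2 ∣ Nat.lcmUpto m := by
  unfold Nat.lcmUpto
  exact Finset.dvd_lcm (Finset.mem_Icc.2 ⟨by norm_num, hm⟩)

/-- An even integer has `v₂ ≤ exp(−1)`. [folklore] -/
private theorem padicValuation_le_of_two_dvd {z : ℤ} (h : (2 : ℤ) ∣ z) :
    Rat.padicValuation 2 (z : ℚ) ≤ exp (-1) := by
  obtain ⟨c, rfl⟩ := h
  rw [Int.cast_mul, map_mul, show ((2 : ℤ) : ℚ) = ((2 : ℕ) : ℚ) by norm_num, Rat.padicValuation_self]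
  calc exp (-1) * Rat.padicValuation 2 (c : ℚ) ≤ exp (-1) * 1 :=
      mul_le_mul' le_rfl (padicValuation_intCast_le_one 2 c)
    _ = exp (-1) := mul_one _

/-! ### The parities of the four coefficients of the contiguity -/

/-- **`b₀(n)` is odd for even `n`**: for `m` odd (`n = m + 1` even), `v₂(Q0 m) = v₂(b₀(n)) = 1`
(`b₀(n) ≡ 2871 ≡ 1 (mod 2)`). -/
theorem padicValuation_Q0_eq_one {m : ℕ} (hm : Odd m) : Rat.padicValuation 2 (Q0 m) = 1 := by
  set B : ℤ := 41218 * ((m : ℤ) + 1) ^ 3 + 48459 * ((m : ℤ) + 1) ^ 2 + 20010 * ((m : ℤ) + 1) + 2871 with hB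
  have hQ : Q0 m = (B : ℚ) := by
    simp only [Q0, b₀_eq, hB]; push_cast; ring
  have hm1 : ((m : ℤ) : ZMod 2) = 1 := by
    obtain ⟨j, rfl⟩ := hm
    push_cast
    rw [show (2 : ZMod 2) = 0 from rfl]; ring
  have h2 : ¬ ((2 : ℕ) : ℤ) ∣ B := by
    intro h
    have h0 : ((B : ℤ) : ZMod 2) = 0 := (ZMod.intCast_zmod_eq_zero_iff_dvd B 2).2 (by exact_mod_cast h)
    have hdec : ∀ x : ZMod 2, x = 1 →
        (41218 : ZMod 2) * (x + 1) ^ 3 + 48459 * (x + 1) ^ 2 + 20010 * (x + 1) + 2871 ≠ 0 := by decide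
    have hcast : ((B : ℤ) : ZMod 2) = (41218 : ZMod 2) * ((m : ZMod 2) + 1) ^ 3 + 48459 * ((m : ZMod 2) + 1) ^ 2 +
        20010 * ((m : ZMod 2) + 1) + 2871 := by
      rw [hB]; push_cast; ring
    have hm1' : ((m : ℕ) : ZMod 2) = 1 := by exact_mod_cast hm1
    exact hdec (m : ZMod 2) hm1' (hcast ▸ h0)
  rw [hQ, Rat.padicValuation_cast]
  exact Int.padicValuation_eq_one_iff.2 h2

/-- **`c_B(n)` is even for odd `n`**: for `m` even, `2 ∣ 3(10130n⁵ + 19198n⁴ + 16675n³ + 8207n² + 2233n + 261)`, `n = m+1`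
(four odd summands). -/
theorem two_dvd_cB {m : ℕ} (hm : Even m) :
    (2 : ℤ) ∣ 3 * (10130 * ((m : ℤ) + 1) ^ 5 + 19198 * ((m : ℤ) + 1) ^ 4 + 16675 * ((m : ℤ) + 1) ^ 3 +
      8207 * ((m : ℤ) + 1) ^ 2 + 2233 * ((m : ℤ) + 1) + 261) := by
  have hm0 : ((m : ℤ) : ZMod 2) = 0 := by
    obtain ⟨j, rfl⟩ := hm
    push_cast
    rw [← two_mul, show (2 : ZMod 2) = 0 from rfl, zero_mul]
  have hdec : ∀ x : ZMod 2, x = 0 → (3 : ZMod 2) * (10130 * (x + 1) ^ 5 + 19198 * (x + 1) ^ 4 + 16675 * (x + 1) ^ 3 +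
      8207 * (x + 1) ^ 2 + 2233 * (x + 1) + 261) = 0 := by decide
  refine (ZMod.intCast_zmod_eq_zero_iff_dvd _ 2).1 ?_
  push_cast
  exact hdec _ hm0

/-! ### The lossless transport -/

/-- **THE TRANSPORT IS LOSSLESS.**  If `x, x̃` satisfy the cell's partner contiguity (`Contig x x̃`: `b₀(n)x̃ₙ =
−196n⁵xₙ₋₁ + c_B(n)xₙ − 87(n+1)⁵xₙ₊₁`, `n ≥ 1`), `k ≤ 5`, and `ord₂(D_m^k x_m) ≥ −M` for every `m`, then
`ord₂(D_n^k x̃ₙ) ≥ −M` for every `n ≥ 2`, and for every `n ≥ 1` if `k ≤ 4`.  (`n` even: `b₀(n)` odd.  `n` odd: `b₀(n) ≡ 2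
(mod 4)` while the three right-hand coefficients `−196n⁵(D_n/D_{n−1})^k`, `c_B(n)`, `−87(n+1)^{5−k}g^k` (`g = gcd(D_n, n+1)`,
`D_n^k(n+1)⁵xₙ₊₁ = (n+1)^{5−k}g^k·D_{n+1}^kxₙ₊₁`) are all even.)  Compare ct-1 g40's `transport` (conclusion `−M − 1`). -/
theorem transport_lossless {x xt : ℕ → ℚ} (hC : Contig x xt) {k : ℕ} (hk : k ≤ 5) {M : ℤ}
    (hx : ∀ m : ℕ, Rat.padicValuation 2 ((Nat.lcmUpto m : ℚ) ^ k * x m) ≤ exp M) {n : ℕ}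
    (hn : 2 ≤ n ∨ (1 ≤ n ∧ k ≤ 4)) :
    Rat.padicValuation 2 ((Nat.lcmUpto n : ℚ) ^ k * xt n) ≤ exp M := by
  obtain ⟨m, rfl⟩ : ∃ m, n = m + 1 := ⟨n - 1, by omega⟩
  have hmk : 1 ≤ m ∨ k ≤ 4 := by omega
  obtain ⟨a, ha⟩ := lcmUpto_dvd_succ m
  set g : ℕ := Nat.gcd (Nat.lcmUpto (m + 1)) (m + 2) with hg
  have hgD : Nat.lcmUpto (m + 1) * (m + 2) = g * Nat.lcmUpto (m + 2) := lcmUpto_mul_succ (m + 1)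
  set D : ℚ := (Nat.lcmUpto (m + 1) : ℚ) with hD
  have haQ : D = (Nat.lcmUpto m : ℚ) * (a : ℚ) := by rw [hD, ha]; push_cast; ring
  have hgQ : D * ((m : ℚ) + 2) = (g : ℚ) * (Nat.lcmUpto (m + 2) : ℚ) := by
    have := congrArg (fun z : ℕ => (z : ℚ)) hgD
    push_cast at this
    rw [hD, ← this]
  -- the three right-hand coefficients, as integers
  set c₁ : ℤ := -196 * ((m : ℤ) + 1) ^ 5 * (a : ℤ) ^ k with hc₁
  set c₂ : ℤ := 3 * (10130 * ((m : ℤ) + 1) ^ 5 + 19198 * ((m : ℤ) + 1) ^ 4 + 16675 * ((m : ℤ) + 1) ^ 3 +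
      8207 * ((m : ℤ) + 1) ^ 2 + 2233 * ((m : ℤ) + 1) + 261) with hc₂
  set c₃ : ℤ := -87 * ((m : ℤ) + 2) ^ (5 - k) * (g : ℤ) ^ k with hc₃
  -- the contiguity, multiplied by `D^k`, with the three terms in transported form
  have key : Q0 m * (D ^ k * xt (m + 1)) =
      (c₁ : ℚ) * ((Nat.lcmUpto m : ℚ) ^ k * x m) + (c₂ : ℚ) * (D ^ k * x (m + 1)) +
        (c₃ : ℚ) * ((Nat.lcmUpto (m + 2) : ℚ) ^ k * x (m + 2)) := by
    have h5 : ((m : ℚ) + 2) ^ 5 = ((m : ℚ) + 2) ^ (5 - k) * ((m : ℚ) + 2) ^ k := by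
      rw [← pow_add, Nat.sub_add_cancel hk]
    have e3 : QC m * x (m + 2) * D ^ k = (c₃ : ℚ) * ((Nat.lcmUpto (m + 2) : ℚ) ^ k * x (m + 2)) := by
      rw [QC, h5, hc₃]
      have : (D * ((m : ℚ) + 2)) ^ k = (g : ℚ) ^ k * ((Nat.lcmUpto (m + 2) : ℚ)) ^ k := by rw [hgQ, mul_pow]
      push_cast
      calc -87 * (((m : ℚ) + 2) ^ (5 - k) * ((m : ℚ) + 2) ^ k) * x (m + 2) * D ^ k
          = -87 * ((m : ℚ) + 2) ^ (5 - k) * (D * ((m : ℚ) + 2)) ^ k * x (m + 2) := by rw [mul_pow]; ring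
        _ = _ := by rw [this]; ring
    have e1 : QA m * x m * D ^ k = (c₁ : ℚ) * ((Nat.lcmUpto m : ℚ) ^ k * x m) := by
      rw [QA, hc₁, haQ, mul_pow]; push_cast; ring
    have e2 : QB m = (c₂ : ℚ) := by rw [QB, hc₂]; push_cast; ring
    calc Q0 m * (D ^ k * xt (m + 1)) = (Q0 m * xt (m + 1)) * D ^ k := by ring
      _ = (QA m * x m + QB m * x (m + 1) + QC m * x (m + 2)) * D ^ k := by rw [hC m]
      _ = QA m * x m * D ^ k + QB m * (D ^ k * x (m + 1)) + QC m * x (m + 2) * D ^ k := by ring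
      _ = _ := by rw [e1, e2, e3]
  -- parity budget: `c : ℤ` with `exp c ≤ v(b₀)` and `v(cᵢ) ≤ exp c` (`c = 0` for `m` odd, `c = −1` for `m` even)
  obtain ⟨c, hq, h1, h2, h3⟩ : ∃ c : ℤ, exp c ≤ Rat.padicValuation 2 (Q0 m) ∧
      Rat.padicValuation 2 (c₁ : ℚ) ≤ exp c ∧ Rat.padicValuation 2 (c₂ : ℚ) ≤ exp c ∧
        Rat.padicValuation 2 (c₃ : ℚ) ≤ exp c := by
    rcases Nat.even_or_odd m with hm | hm
    · refine ⟨-1, exp_neg_one_le_padicValuation_Q0 m, padicValuation_le_of_two_dvd ⟨-98 * ((m : ℤ) + 1) ^ 5 * (a : ℤ) ^ k,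
        by rw [hc₁]; ring⟩, padicValuation_le_of_two_dvd (two_dvd_cB hm), padicValuation_le_of_two_dvd ?_⟩
      -- `c₃ = −87(m+2)^{5−k}g^k` is even: `m + 2` is even and, for `k = 5`, `g = gcd(D_{m+1}, m+2)` is even (`m ≥ 2`)
      have hm2 : (2 : ℤ) ∣ (m : ℤ) + 2 := by
        obtain ⟨j, rfl⟩ := hm; exact ⟨(j : ℤ) + 1, by push_cast; ring⟩
      rcases hmk with hm1 | hk4
      · have hm2' : 2 ≤ m := by
          obtain ⟨j, rfl⟩ := hm; omega
        have hg2 : (2 : ℤ) ∣ (g : ℤ) := by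
          have : 2 ∣ g := by
            rw [hg]
            exact Nat.dvd_gcd (two_dvd_lcmUpto (by omega)) (by obtain ⟨j, rfl⟩ := hm; exact ⟨j + 1, by omega⟩)
          exact_mod_cast this
        rcases Nat.eq_zero_or_pos k with hk0 | hkpos
        · subst hk0
          rw [hc₃]
          exact Dvd.dvd.mul_right (Dvd.dvd.mul_left (dvd_pow hm2 (by norm_num)) _) _
        · rw [hc₃]
          exact Dvd.dvd.mul_left (dvd_pow hg2 (by omega)) _
      · rw [hc₃]
        exact Dvd.dvd.mul_right (Dvd.dvd.mul_left (dvd_pow hm2 (by omega)) _) _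
    · refine ⟨0, ?_, ?_, ?_, ?_⟩
      · rw [exp_zero, padicValuation_Q0_eq_one hm]
      · rw [exp_zero]; exact padicValuation_intCast_le_one 2 _
      · rw [exp_zero]; exact padicValuation_intCast_le_one 2 _
      · rw [exp_zero]; exact padicValuation_intCast_le_one 2 _
  have hx1 := hx m
  have hx2 := hx (m + 1)
  have hx3 := hx (m + 2)
  rw [← hD] at hx2
  have hsum : Rat.padicValuation 2 (Q0 m * (D ^ k * xt (m + 1))) ≤ exp c * exp M := by
    rw [key]
    refine (Valuation.map_add _ _ _).trans (max_le ((Valuation.map_add _ _ _).trans (max_le ?_ ?_)) ?_)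
    · rw [map_mul]; exact mul_le_mul' h1 hx1
    · rw [map_mul]; exact mul_le_mul' h2 hx2
    · rw [map_mul]; exact mul_le_mul' h3 hx3
  rw [map_mul] at hsum
  calc Rat.padicValuation 2 (D ^ k * xt (m + 1))
      = exp (-c) * (exp c * Rat.padicValuation 2 (D ^ k * xt (m + 1))) := by
        rw [← mul_assoc, ← exp_add, neg_add_cancel, exp_zero, one_mul]
    _ ≤ exp (-c) * (Rat.padicValuation 2 (Q0 m) * Rat.padicValuation 2 (D ^ k * xt (m + 1))) :=
        mul_le_mul' le_rfl (mul_le_mul' hq le_rfl)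
    _ ≤ exp (-c) * (exp c * exp M) := mul_le_mul' le_rfl hsum
    _ = exp M := by rw [← mul_assoc, ← exp_add, neg_add_cancel, exp_zero, one_mul]

/-- **The partner half inherits the `r`-half exponents verbatim.**  `ord₂(uₘ) ≥ −Mᵤ`, `ord₂(D_m²wₘ) ≥ −M_w`,
`ord₂(D_m⁵vₘ) ≥ −Mᵥ` for all `m` give `ord₂(ũₙ) ≥ −Mᵤ`, `ord₂(D_n²w̃ₙ) ≥ −M_w`, `ord₂(D_n⁵ṽₙ) ≥ −Mᵥ` for every `n ≥ 2`, by
`transport_lossless` along `contig_uC`, `contig_wC`, `contig_vC`.  (ct-1 g40's `partner_two_adic_of_rHalf`: exponents `+1`.) -/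
theorem partner_of_rHalf {Mu Mw Mv : ℤ}
    (h : ∀ m : ℕ, Rat.padicValuation 2 (uC m) ≤ exp Mu ∧
      Rat.padicValuation 2 ((Nat.lcmUpto m : ℚ) ^ 2 * wC m) ≤ exp Mw ∧
        Rat.padicValuation 2 ((Nat.lcmUpto m : ℚ) ^ 5 * vC m) ≤ exp Mv)
    {n : ℕ} (hn : 2 ≤ n) :
    Rat.padicValuation 2 (utC n) ≤ exp Mu ∧
      Rat.padicValuation 2 ((Nat.lcmUpto n : ℚ) ^ 2 * wtC n) ≤ exp Mw ∧
        Rat.padicValuation 2 ((Nat.lcmUpto n : ℚ) ^ 5 * vtC n) ≤ exp Mv := by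
  refine ⟨?_, ?_, ?_⟩
  · have hx : ∀ m : ℕ, Rat.padicValuation 2 ((Nat.lcmUpto m : ℚ) ^ 0 * uC m) ≤ exp Mu := fun m => by
      rw [pow_zero, one_mul]; exact (h m).1
    have := transport_lossless contig_uC (by norm_num) hx (Or.inl hn)
    rwa [pow_zero, one_mul] at this
  · exact transport_lossless contig_wC (by norm_num) (fun m => (h m).2.1) (Or.inl hn)
  · exact transport_lossless contig_vC le_rfl (fun m => (h m).2.2) (Or.inl hn)

/-- For `uₙ` and `wₙ` (`k ≤ 4`) the transport is lossless from `n = 1` on. -/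
theorem partner_of_rHalf_uw {Mu Mw : ℤ}
    (h : ∀ m : ℕ, Rat.padicValuation 2 (uC m) ≤ exp Mu ∧
      Rat.padicValuation 2 ((Nat.lcmUpto m : ℚ) ^ 2 * wC m) ≤ exp Mw)
    {n : ℕ} (hn : 1 ≤ n) :
    Rat.padicValuation 2 (utC n) ≤ exp Mu ∧ Rat.padicValuation 2 ((Nat.lcmUpto n : ℚ) ^ 2 * wtC n) ≤ exp Mw := by
  refine ⟨?_, ?_⟩
  · have hx : ∀ m : ℕ, Rat.padicValuation 2 ((Nat.lcmUpto m : ℚ) ^ 0 * uC m) ≤ exp Mu := fun m => by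
      rw [pow_zero, one_mul]; exact (h m).1
    have := transport_lossless contig_uC (by norm_num) hx (Or.inr ⟨hn, by norm_num⟩)
    rwa [pow_zero, one_mul] at this
  · exact transport_lossless contig_wC (by norm_num) (fun m => (h m).2) (Or.inr ⟨hn, by norm_num⟩)

/-! ### `Zudilin2002.integrality` from the first line of (14) alone -/

/-- **`Zudilin2002.integrality` from the `2`-adic content of the first line of Zudilin's (14).**  If for every `n`
`ord₂(uₙ) ≥ −1`, `ord₂(D_n²wₙ) ≥ −1`, `ord₂(D_n⁵vₙ) ≥ −1` (the prime-`2` part of `2uₙ, 2D_n²wₙ, 2D_n⁵vₙ ∈ ℤ`), then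
`4D_n²qₙ, 4D_n⁷pₙ, 4D_n⁵p̃ₙ ∈ ℤ` for all `n ≥ 1`: for `n ≥ 2` the partner gets the same exponents (`partner_of_rHalf`) and
(15) gives `ord₂(D_n⁷pₙ), ord₂(D_n⁵p̃ₙ) ≥ −2` (ct-1 g39's `two_adic_of_coeffs`); `n = 1` is inside the cell's certificate
(`two_adic_upto_fifty`); odd primes and the `q`-conjunct by `integrality_iff_two_adic`.
[cite: Zudilin2002Zeta5, Sect. 1 (display before (6)) and Sect. 2 (14)–(15)] -/
theorem integrality_of_rHalf_printed
    (h : ∀ m : ℕ, Rat.padicValuation 2 (uC m) ≤ exp 1 ∧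
      Rat.padicValuation 2 ((Nat.lcmUpto m : ℚ) ^ 2 * wC m) ≤ exp 1 ∧
        Rat.padicValuation 2 ((Nat.lcmUpto m : ℚ) ^ 5 * vC m) ≤ exp 1) :
    integrality :=
  integrality_iff_two_adic.mpr fun n hn => by
    rcases Nat.lt_or_ge n 2 with h2 | h2
    · exact two_adic_upto_fifty hn (by omega)
    · obtain ⟨hut, hwt, hvt⟩ := partner_of_rHalf h h2
      exact two_adic_of_coeffs n (h n).1 (h n).2.1 (h n).2.2 hut hwt hvt

/-- From `2x ∈ ℤ` to `v₂(x) ≤ exp 1`. [folklore] -/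
private theorem padicValuation_le_exp_one_of_two_mul {x : ℚ} (h : ∃ z : ℤ, 2 * x = z) :
    Rat.padicValuation 2 x ≤ exp 1 := by
  obtain ⟨z, hz⟩ := h
  have h' : Rat.padicValuation 2 (((2 : ℕ) : ℚ) ^ 1 * x) ≤ exp (-(0 : ℤ)) := by
    rw [pow_one, Nat.cast_ofNat, hz, neg_zero, exp_zero]
    exact padicValuation_intCast_le_one 2 z
  simpa using le_exp_of_pow_mul_le (p := 2) h'

/-- **`Zudilin2002.integrality` from the first line `2uₙ ∈ ℤ, 2D_n²wₙ ∈ ℤ, 2D_n⁵vₙ ∈ ℤ` of (14) for the `r`-series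
ALONE** (all `n`); the partner line of (14) is not needed.  In print both lines come from Vasilyev's integrals and
Zudilin's theorem on the coincidence of very-well-poised series with generalized Beukers integrals.
[cite: Zudilin2002Zeta5, Sect. 2 (14)–(15) and Sect. 1 (display before (6))] -/
theorem integrality_of_fourteen_rHalf
    (h : ∀ n : ℕ, (∃ z : ℤ, 2 * uC n = z) ∧ (∃ z : ℤ, 2 * ((Nat.lcmUpto n : ℚ) ^ 2 * wC n) = z) ∧
      (∃ z : ℤ, 2 * ((Nat.lcmUpto n : ℚ) ^ 5 * vC n) = z)) :
    integrality :=
  integrality_of_rHalf_printed fun n =>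
    ⟨padicValuation_le_exp_one_of_two_mul (h n).1, padicValuation_le_exp_one_of_two_mul (h n).2.1,
      padicValuation_le_exp_one_of_two_mul (h n).2.2⟩

/-! ### The same in the vocabulary of the brick kernel `(6,1,1)` -/

/-- **`Zudilin2002.integrality` from `2`-adic bounds on the brick data of the kernel `(6,1,1)`**: `ord₂(x_5(n)) ≥ −1`,
`ord₂(D_n²x_3(n)) ≥ −1`, `ord₂(D_n⁵x_0(n)) ≥ −1` for all `n` (`uₙ = x_5(n)`, `wₙ = x_3(n)`, `vₙ = −x_0(n)`, `BrickLinearForms`).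
At every ODD prime the sharper `ord_p ≥ 0` is the tree's `BrickDenominators.padicValuation_lcmUpto_pow_mul_xCoeff_le` /
`…_xZero_le`. [cite: Zudilin2002Zeta5, Sect. 2 (14)–(15)] -/
theorem integrality_of_brick_two
    (h : ∀ n : ℕ, Rat.padicValuation 2 (xCoeff 6 1 1 n 5) ≤ exp 1 ∧
      Rat.padicValuation 2 ((Nat.lcmUpto n : ℚ) ^ 2 * xCoeff 6 1 1 n 3) ≤ exp 1 ∧
        Rat.padicValuation 2 ((Nat.lcmUpto n : ℚ) ^ 5 * xZero 6 1 1 n) ≤ exp 1) :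
    integrality :=
  integrality_of_rHalf_printed fun n => by
    obtain ⟨h5, h3, h0⟩ := h n
    refine ⟨by rwa [uC_eq_xCoeff], by rwa [wC_eq_xCoeff], ?_⟩
    rw [vC_eq_neg_xZero, mul_neg, Valuation.map_neg]
    exact h0

/-- **A constant-weight PROPOSITION H^∞ at `p = 2` that loses one factor `2` closes the named fact.**  If for every
level `L` and every `n < 2^{L+1}`: `v₂(2^{6L}·x_0(n)) ≤ exp(1 − L)` and `v₂(2^{L(6−s)}·x_s(n)) ≤ exp(1 − L)` for `s = 3, 5`
(the shape of `BrickDenominators.level_const` — proved there for every ODD prime with `exp(−L)` — weakened by one factor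
`2`), then `Zudilin2002.integrality`.  (`L = ⌊log₂ n⌋`, `v₂(D_n) = exp(−L)`: the level bounds are `ord₂(x_5) ≥ −1`,
`ord₂(D_n²x_3) ≥ −1`, `ord₂(D_n⁵x_0) ≥ −1`.) [cite: Zudilin2002Zeta5, Sect. 2 (14)–(15)] -/
theorem integrality_of_level_two
    (h : ∀ L n : ℕ, n < 2 ^ (L + 1) →
      Rat.padicValuation 2 ((2 : ℚ) ^ (L * 6) * xZero 6 1 1 n) ≤ exp (1 - (L : ℤ)) ∧
        Rat.padicValuation 2 ((2 : ℚ) ^ (L * (6 - 3)) * xCoeff 6 1 1 n 3) ≤ exp (1 - (L : ℤ)) ∧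
          Rat.padicValuation 2 ((2 : ℚ) ^ (L * (6 - 5)) * xCoeff 6 1 1 n 5) ≤ exp (1 - (L : ℤ))) :
    integrality := by
  haveI : Fact (Nat.Prime 2) := ⟨Nat.prime_two⟩
  refine integrality_of_brick_two fun n => ?_
  set L : ℕ := Nat.log 2 n with hL
  have hn : n < 2 ^ (L + 1) := Nat.lt_pow_succ_log_self (by norm_num) n
  obtain ⟨h0, h3, h5⟩ := h L n hn
  have hD : Rat.padicValuation 2 ((Nat.lcmUpto n : ℚ)) = exp (-(L : ℤ)) := by
    rw [hL]; exact_mod_cast padicValuation_lcmUpto (p := 2) n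
  -- from `v₂(2^{L(j+1)}·y) ≤ exp(1 − L)` to `v₂(D_n^j·y) ≤ exp 1`
  have conv : ∀ (y : ℚ) (j e : ℕ), e = L * (j + 1) →
      Rat.padicValuation 2 ((2 : ℚ) ^ e * y) ≤ exp (1 - (L : ℤ)) →
        Rat.padicValuation 2 ((Nat.lcmUpto n : ℚ) ^ j * y) ≤ exp 1 := by
    intro y j e he hy
    subst he
    rw [show (1 : ℤ) - L = -((L : ℤ) - 1) by ring, show (2 : ℚ) = ((2 : ℕ) : ℚ) by norm_num] at hy
    have hy' := le_exp_of_pow_mul_le (p := 2) hy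
    rw [map_mul, map_pow, hD, ← exp_nsmul, nsmul_eq_mul]
    calc exp ((j : ℤ) * -(L : ℤ)) * Rat.padicValuation 2 y
        ≤ exp ((j : ℤ) * -(L : ℤ)) * exp (((L * (j + 1) : ℕ) : ℤ) - ((L : ℤ) - 1)) := mul_le_mul' le_rfl hy'
      _ = exp 1 := by rw [← exp_add]; congr 1; push_cast; ring
  refine ⟨?_, conv _ 2 _ (by norm_num) h3, conv _ 5 _ (by ring) h0⟩
  have := conv (xCoeff 6 1 1 n 5) 0 _ (by norm_num) h5
  simpa only [pow_zero, one_mul] using this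

end Summit.KontsevichZagierPeriods.Zeta5Search.Zudilin2002IntegralityLossless
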